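import Summits.KontsevichZagierPeriods.KontsevichZagierPeriods.Theses.AyoubSpecialisation

/-!
# `Assembly` (stmt-KontsevichZagierPeriods-0361, route AyoubSpecialisation) — proof

The route's assembly item `PiProductRep → AyoubPiCancellation → AyoubPiLocalKernel →
KontsevichZagierPeriods` is its gate-verified deciding theorem
`Summit.KontsevichZagierPeriods.KontsevichZagierPeriods.Theses.AyoubSpecialisation.closes` read as
an implication (binders reordered / dropped as needed); the antecedents are the route's cruxes and
are NOT discharged here: the theorem is the implication, nothing more. The hypotheses of the chain
not consumed by `closes` are dropped. (Lead c10 of crux stmt-KontsevichZagierPeriods-9129, banking.)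
No definitions are introduced.

References: M. Kontsevich, D. Zagier, *Periods* (2001), §1.2, Conjecture 1.
-/

namespace Summit.KontsevichZagierPeriods.AyoubSpecialisation

/-- **Assembly of route AyoubSpecialisation** (stmt-KontsevichZagierPeriods-0361): `PiProductRep →
AyoubPiCancellation → AyoubPiLocalKernel → KontsevichZagierPeriods` — the cruxes imply the summit,
by the route's deciding theorem `closes`. [Kontsevich–Zagier 2001, §1.2] [folklore] -/
theorem assembly_proof :
    Summit.KontsevichZagierPeriods.KontsevichZagierPeriods.Theses.AyoubSpecialisation.Assembly :=
  fun _ h₂ h₃ =>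
    Summit.KontsevichZagierPeriods.KontsevichZagierPeriods.Theses.AyoubSpecialisation.closes h₂ h₃

end Summit.KontsevichZagierPeriods.AyoubSpecialisation
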